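import Summits.Ventures.QEC.Census.CertCoverOrbit
import HarnessLib

/-!
# Cover reduction, part 6: Bool forms of the per-problem side conditions, generated word lists, witness tables,
# composite transport, and push-forwards of kernel generators (assembly glue)
# (qec lane ε, director-qec R29; census/search-9/cover/README.md §3, type-10 review §C/G3/G4)

Everything a code-specific ASSEMBLY file needs to turn `decide`d tables into the hypotheses of the level lemmas
(`Census/CertCoverLevel.lean`) and of the transports (`Census/CertCoverOrbit.lean`):
* `buEvenOK` / `labelCheckOK` ⇒ the `hBU` / `hallow` hypotheses of `level_label_core`;
* `listGen c P s` — the finitely many words the list-form lemma produces for problem `P` of `s`, `mem_listGen`;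
* `CoverWitness`, `witnessOK`, `coveredOK` — «every listed word `w` is carried by the listed automorphism `aut` to the
  representative `rep`» as a table, `exists_witness_of_coveredOK`;
* `liftOK_transport2` — transport through TWO cover steps (`P₂ ∘ P₁`, e.g. `288 → 144 → 72`);
* `annihilatesOK` / `kernelGensOK` + `popc_and_push_even_of_gens`, `synZero_push_of_gens` — if the functionals `Λ`
  downstairs are even on the push-forward of every generator of `ker H^X` upstairs (stabilizer rows + logicals), they
  are even on `P v` for every `v ∈ ker H^X`; likewise `P v ∈ ker H̄^X` from the generators (L-M of README §4 as tables);
* `Cover2.push_xorSel` — `P` commutes with row selections.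
HONEST FRAMING: generic; everything proved; no instances, no notation.
-/

namespace Summit.Ventures.QEC.Census

open Matrix Literature.InformationTheory.QuantumCodes

/-! ## Side conditions of `level_label_core` as Bool checks -/

/-- The functionals' push-forwards are even on every inside-`U` kernel row. (definition) -/
def buEvenOK (c : Cover2) (P : CosetProb) (Lam : List ℕ) : Bool :=
  Lam.all fun l => P.BU.all fun b => popc c.nq (c.push l &&& b) % 2 == 0

/-- `buEvenOK` ⇒ hypothesis `hBU`. -/
theorem hBU_of_buEvenOK {c : Cover2} {P : CosetProb} {Lam : List ℕ} (h : buEvenOK c P Lam = true) :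
    ∀ l ∈ Lam, ∀ b ∈ P.BU, popc c.nq (c.push l &&& b) % 2 = 0 := by
  simp only [buEvenOK, List.all_eq_true, beq_iff_eq] at h
  exact h

/-- The LABEL CHECK on every allow-list entry: `⟨l, lift₀ u⟩ + ⟨P l, y0 ⊕ xorSel G (selOf T a)⟩ ≡ 0`. (definition) -/
def labelCheckOK (c : Cover2) (P : CosetProb) (u : ℕ) (Lam : List ℕ) : Bool :=
  P.allow.all fun a => Lam.all fun l =>
    (popc c.n (l &&& c.lift0 u) + popc c.nq (c.push l &&& (P.y0 ^^^ xorSel P.G (selOf P.T a)))) % 2 == 0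

/-- `labelCheckOK` ⇒ hypothesis `hallow`. -/
theorem hallow_of_labelCheckOK {c : Cover2} {P : CosetProb} {u : ℕ} {Lam : List ℕ}
    (h : labelCheckOK c P u Lam = true) :
    ∀ a ∈ P.allow, ∀ l ∈ Lam,
      (popc c.n (l &&& c.lift0 u) + popc c.nq (c.push l &&& (P.y0 ^^^ xorSel P.G (selOf P.T a)))) % 2 = 0 := by
  simp only [labelCheckOK, List.all_eq_true, beq_iff_eq] at h
  exact h

/-! ## The generated word list of a list-form problem -/

/-- All words `lift₀ s ⊕ P* (y0 ⊕ xorSel G (selOf T a) ⊕ xorSel BU m)`, `a ∈ allow`, `m < 2^|BU|`. (definition) -/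
def listGen (c : Cover2) (P : CosetProb) (s : ℕ) : List ℕ :=
  P.allow.flatMap fun a => (List.range (2 ^ P.BU.length)).map fun m =>
    c.lift0 s ^^^ c.pull (P.y0 ^^^ xorSel P.G (selOf P.T a) ^^^ xorSel P.BU m)

/-- Membership in the generated list. -/
theorem mem_listGen {c : Cover2} {P : CosetProb} {s a m : ℕ} (ha : a ∈ P.allow) (hm : m < 2 ^ P.BU.length) :
    c.lift0 s ^^^ c.pull (P.y0 ^^^ xorSel P.G (selOf P.T a) ^^^ xorSel P.BU m) ∈ listGen c P s := by
  rw [listGen, List.mem_flatMap]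
  exact ⟨a, ha, List.mem_map.2 ⟨m, List.mem_range.2 hm, rfl⟩⟩

/-! ## Witness tables -/

/-- One transport witness: the listed word `w` is carried by automorphism number `aut` to representative number
`rep`. -/
structure CoverWitness where
  /-- the word downstairs -/
  w : ℕ
  /-- index into the list of downstairs permutation tables -/
  aut : ℕ
  /-- index into the list of representatives -/
  rep : ℕ

/-- Every witness is in range and its permutation carries `w` to the named representative. (definition) -/
def witnessOK (nq : ℕ) (permqs : List (List ℕ)) (reps : List ℕ) (tab : List CoverWitness) : Bool :=
  tab.all fun t => decide (t.aut < permqs.length) && decide (t.rep < reps.length) &&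
    (permWord (permFun (permqs.getD t.aut [])) t.w nq == reps.getD t.rep 0)

/-- Every word of the list has a witness. (definition) -/
def coveredOK (words : List ℕ) (tab : List CoverWitness) : Bool :=
  words.all fun w => tab.any fun t => t.w == w

/-- From the two tables: every covered word is carried by a listed permutation to a listed representative. -/
theorem exists_witness_of_coveredOK {nq : ℕ} {permqs : List (List ℕ)} {reps : List ℕ} {tab : List CoverWitness}
    {words : List ℕ} (hw : witnessOK nq permqs reps tab = true) (hc : coveredOK words tab = true) {w : ℕ}
    (hmem : w ∈ words) :
    ∃ i < permqs.length, ∃ j < reps.length, permWord (permFun (permqs.getD i [])) w nq = reps.getD j 0 := by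
  simp only [coveredOK, List.all_eq_true, List.any_eq_true, beq_iff_eq] at hc
  obtain ⟨t, ht, htw⟩ := hc w hmem
  simp only [witnessOK, List.all_eq_true, Bool.and_eq_true, decide_eq_true_eq, beq_iff_eq] at hw
  obtain ⟨⟨ha, hr⟩, he⟩ := hw t ht
  exact ⟨t.aut, ha, t.rep, hr, by rw [← htw]; exact he⟩

/-! ## Transport through two cover steps -/

/-- **Composite transport** (`P₂ ∘ P₁`): if no bad word of weight `≤ W` upstairs has `P₂ (P₁ v) = s_rep`, and the
permutation triple `(perm, permq, permqq)` is compatible with both cover steps with `permqq · s = s_rep`, then no bad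
word of weight `≤ W` has `P₂ (P₁ v) = s`. -/
theorem liftOK_transport2 {c c₂ : Cover2} (hc : c.ok = true) (hc₂ : c₂.ok = true) (hn : c₂.n = c.nq)
    {HX HZ perm permq permqq rowsX rowsZ : List ℕ}
    (hcomm : rowMatrix c.n HX * (rowMatrix c.n HZ)ᵀ = 0) (hcompat : c.permCompatOK perm permq = true)
    (hcompat₂ : c₂.permCompatOK permq permqq = true)
    (hX : rowMapOK c.n HX perm rowsX = true) (hZ : rowMapOK c.n HZ perm rowsZ = true) {srep s W : ℕ}
    (hrep : ∀ v : ℕ, v < 2 ^ c.n → synZero c.n HX v = true → ofBits c.n v ∉ rowSpace (rowMatrix c.n HZ) →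
      popc c.n v ≤ W → c₂.push (c.push v) ≠ srep)
    (hs : permWord (permFun permqq) s c₂.nq = srep) :
    ∀ v : ℕ, v < 2 ^ c.n → synZero c.n HX v = true → ofBits c.n v ∉ rowSpace (rowMatrix c.n HZ) →
      popc c.n v ≤ W → c₂.push (c.push v) ≠ s := by
  have hperm : permListOK c.n perm = true := by
    simp only [Cover2.permCompatOK, Bool.and_eq_true] at hcompat; exact hcompat.1.1
  intro v hv hsyn hnot hwt hpu
  obtain ⟨hsyn', hnot'⟩ := bad_permWord hcomm hperm hX hZ hsyn hnot
  refine hrep _ (permWord_permFun_lt_two_pow hperm v) hsyn' hnot' ?_ ?_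
  · rw [popc_permWord_permFun hperm v]; exact hwt
  · rw [Cover2.push_permWord hc hcompat, ← hn, Cover2.push_permWord hc₂ hcompat₂, hpu, hs]

/-! ## Push-forwards of kernel generators -/

/-- `P` commutes with row selections: `P (xorSel L m) = xorSel (L.map P) m`. -/
theorem Cover2.push_xorSel (c : Cover2) : ∀ (L : List ℕ) (m : ℕ), c.push (xorSel L m) = xorSel (L.map c.push) m
  | [], _ => by
    simp only [xorSel, List.map_nil]
    apply Nat.eq_of_testBit_eq; intro p
    rw [Nat.zero_testBit, Cover2.push, testBit_mkBits]; simp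
  | r :: rs, m => by
    rw [List.map_cons, xorSel, xorSel, c.push_xor, Cover2.push_xorSel c rs (m / 2)]
    congr 1
    split
    · rfl
    · apply Nat.eq_of_testBit_eq; intro p
      rw [Nat.zero_testBit, Cover2.push, testBit_mkBits]; simp

/-- The functionals `Λ` (downstairs words) are even on the push-forward of every listed generator. (definition) -/
def annihilatesOK (c : Cover2) (Lam gens : List ℕ) : Bool :=
  gens.all fun x => Lam.all fun l => popc c.nq (l &&& c.push x) % 2 == 0

/-- The push-forward of every listed generator has zero syndrome for `Hq`. (definition) -/
def kernelGensOK (c : Cover2) (Hq gens : List ℕ) : Bool := gens.all fun x => synZero c.nq Hq (c.push x)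

/-- If `Λ` is even on the push-forwards of the rows of `L`, it is even on the push-forward of every selection. -/
theorem popc_and_push_xorSel_even {c : Cover2} {Lam L : List ℕ} (h : annihilatesOK c Lam L = true) (m : ℕ) :
    ∀ l ∈ Lam, popc c.nq (l &&& c.push (xorSel L m)) % 2 = 0 := by
  intro l hl
  rw [Cover2.push_xorSel]
  refine popc_and_xorSel_even (fun b hb => ?_) m
  rw [List.mem_map] at hb
  obtain ⟨x, hx, rfl⟩ := hb
  simp only [annihilatesOK, List.all_eq_true, beq_iff_eq] at h
  exact h x hx l hl

/-- A selection of kernel words is a kernel word (syndromes are additive). -/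
theorem synZero_xorSel_of_forall {n : ℕ} {H : List ℕ} : ∀ (L : List ℕ), (∀ b ∈ L, synZero n H b = true) →
    ∀ m : ℕ, synZero n H (xorSel L m) = true
  | [], _, _ => by
    refine synZero_of_synBit fun r hr => ?_
    simp [xorSel, synBit, popc_zero]
  | b :: bs, h, m => by
    rw [xorSel]
    refine synZero_of_synBit fun r hr => ?_
    rw [synBit_xor, synBit_of_synZero (synZero_xorSel_of_forall bs (fun x hx => h x (List.mem_cons_of_mem _ hx)) _) hr]
    split
    · rw [synBit_of_synZero (h b List.mem_cons_self) hr]; rfl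
    · simp [synBit, popc_zero]

/-- If the push-forwards of the rows of `L` are kernel words for `Hq`, so is the push-forward of every selection. -/
theorem synZero_push_xorSel {c : Cover2} {Hq L : List ℕ} (h : kernelGensOK c Hq L = true) (m : ℕ) :
    synZero c.nq Hq (c.push (xorSel L m)) = true := by
  rw [Cover2.push_xorSel]
  refine synZero_xorSel_of_forall _ (fun b hb => ?_) m
  rw [List.mem_map] at hb
  obtain ⟨x, hx, rfl⟩ := hb
  simp only [kernelGensOK, List.all_eq_true] at h
  exact h x hx

/-- **Generators suffice**: a word `v < 2^n` of the form stabilizer-row combination ⊕ logical combination — which by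
L1 is EVERY `v ∈ ker H^X` upstairs — written as `xorSel HZ w ⊕ xorSel LZ w'`, has `P v ∈ ker Hq` and `Λ` even on
`P v` as soon as the two generator tables pass. -/
theorem push_of_gens {c : Cover2} {Hq Lam HZ LZ : List ℕ} (hk : kernelGensOK c Hq (HZ ++ LZ) = true)
    (ha : annihilatesOK c Lam (HZ ++ LZ) = true) (w w' : ℕ) :
    synZero c.nq Hq (c.push (xorSel HZ w ^^^ xorSel LZ w')) = true ∧
      ∀ l ∈ Lam, popc c.nq (l &&& c.push (xorSel HZ w ^^^ xorSel LZ w')) % 2 = 0 := by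
  have hkH : kernelGensOK c Hq HZ = true := by
    simp only [kernelGensOK, List.all_eq_true, List.mem_append] at hk ⊢; exact fun x hx => hk x (Or.inl hx)
  have hkL : kernelGensOK c Hq LZ = true := by
    simp only [kernelGensOK, List.all_eq_true, List.mem_append] at hk ⊢; exact fun x hx => hk x (Or.inr hx)
  have haH : annihilatesOK c Lam HZ = true := by
    simp only [annihilatesOK, List.all_eq_true, List.mem_append] at ha ⊢; exact fun x hx => ha x (Or.inl hx)
  have haL : annihilatesOK c Lam LZ = true := by
    simp only [annihilatesOK, List.all_eq_true, List.mem_append] at ha ⊢; exact fun x hx => ha x (Or.inr hx)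
  constructor
  · rw [c.push_xor]
    refine synZero_of_synBit fun r hr => ?_
    rw [synBit_xor, synBit_of_synZero (synZero_push_xorSel hkH w) hr, synBit_of_synZero (synZero_push_xorSel hkL w') hr]
    rfl
  · intro l hl
    rw [c.push_xor, Nat.and_xor_distrib_left, popc_xor_mod_two, Nat.add_mod,
      popc_and_push_xorSel_even haH w l hl, popc_and_push_xorSel_even haL w' l hl]

end Summit.Ventures.QEC.Census
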